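import Literature.Probability.Distributions.GaussianPiDensity
import Mathlib.Probability.Distributions.Gaussian.Multivariate
import Mathlib.MeasureTheory.Measure.Haar.InnerProductSpace
import HarnessLib

/-!
# The standard Gaussian of an inner product space as a density

`Literature/Probability/Distributions/`. Mathlib's `ProbabilityTheory.stdGaussian E` (the law of
`∑ᵢ ξᵢ bᵢ` for an orthonormal basis `b` and i.i.d. `ξᵢ ∼ N(0,1)`) on a finite-dimensional real
inner product space `E` of dimension `d` is Lebesgue measure with the density
`(2π)^{-d/2} e^{-‖x‖²/2}`:

* `stdGaussian_eq_withDensity` — from the sibling `pi_gaussianReal_eq_smul_withDensity`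
  (`⊗ᵈ N(0,1) = (2π)^{-d/2} e^{-∑xᵢ²/2} dx` on `ℝᵈ`) transported along the volume-preserving
  isometry `x ↦ ∑ xᵢ bᵢ` (`PiLp.volume_preserving_toLp`, `LinearIsometryEquiv.measurePreserving`);
* `stdGaussian_absolutelyContinuous`, `stdGaussian_apply_submodule_eq_zero` — consequently
  `stdGaussian E ≪ dx` and proper subspaces are null.

The same identity, in kinetic-theory notation (`globalMaxwellian`), is
`Literature.Analysis.FluidPDE.stdGaussian_eq_withDensity_globalMaxwellian_holds`; this file gives
it a Mathlib-only proof at the foundational level of `Probability/Distributions`, so that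
probability files need not import the kinetic stack. All [folklore].
-/

noncomputable section

open MeasureTheory ProbabilityTheory Set Real Module
open scoped ENNReal

namespace Literature.Probability.Distributions

variable {E : Type*} [NormedAddCommGroup E] [InnerProductSpace ℝ E] [FiniteDimensional ℝ E]
  [MeasurableSpace E] [BorelSpace E]

/-- Transport of a density along a measure-preserving measurable equivalence:
`e_* (μ.withDensity f) = ν.withDensity (f ∘ e⁻¹)` when `e_* μ = ν`. [folklore] -/
theorem map_withDensity_of_measurePreserving {α β : Type*} [MeasurableSpace α] [MeasurableSpace β]
    {μ : Measure α} {ν : Measure β} (e : α ≃ᵐ β) (he : MeasurePreserving e μ ν) (f : α → ℝ≥0∞) :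
    (μ.withDensity f).map e = ν.withDensity (f ∘ e.symm) := by
  ext s hs
  rw [Measure.map_apply e.measurable hs, withDensity_apply _ (e.measurable hs),
    withDensity_apply _ hs, ← he.map_eq, Measure.restrict_map e.measurable hs,
    lintegral_map_equiv]
  simp only [Function.comp_apply, e.symm_apply_apply]

/-- `(√(2π))⁻ᵈ = (2π)^{-d/2}`. [folklore] -/
theorem inv_sqrt_two_pi_pow (d : ℕ) :
    ((Real.sqrt (2 * π * ((1 : NNReal) : ℝ)))⁻¹) ^ d = (2 * π) ^ (-(d : ℝ) / 2) := by
  rw [NNReal.coe_one, mul_one, Real.sqrt_eq_rpow, ← Real.rpow_neg_one, ← Real.rpow_mul (by positivity),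
    ← Real.rpow_natCast, ← Real.rpow_mul (by positivity)]
  congr 1
  ring

/-- **The standard Gaussian as a density**: on a `d`-dimensional real inner product space,
`stdGaussian E = (2π)^{-d/2} e^{-‖x‖²/2} dx`. [folklore] -/
theorem stdGaussian_eq_withDensity :
    stdGaussian E = (volume : Measure E).withDensity
      fun x => ENNReal.ofReal ((2 * π) ^ (-(finrank ℝ E : ℝ) / 2) * rexp (-‖x‖ ^ 2 / 2)) := by
  set d : ℕ := finrank ℝ E with hd
  set b : OrthonormalBasis (Fin d) ℝ E := stdOrthonormalBasis ℝ E with hb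
  -- the volume-preserving equivalence `ℝᵈ ≃ E`, `x ↦ ∑ xᵢ bᵢ`
  set e : (Fin d → ℝ) ≃ᵐ E :=
    (MeasurableEquiv.toLp 2 (Fin d → ℝ)).trans b.repr.symm.toHomeomorph.toMeasurableEquiv with he
  have he_apply : ∀ x : Fin d → ℝ, e x = ∑ i, x i • b i := by
    intro x
    simp only [he, MeasurableEquiv.trans_apply, MeasurableEquiv.toLp_apply,
      Homeomorph.toMeasurableEquiv_coe, LinearIsometryEquiv.coe_toHomeomorph]
    rw [← b.sum_repr_symm]
  have hmp : MeasurePreserving e (volume : Measure (Fin d → ℝ)) (volume : Measure E) :=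
    (PiLp.volume_preserving_toLp (Fin d)).trans b.repr.symm.measurePreserving
  -- `stdGaussian E = e_* (⊗ N(0,1))`
  have h1 : stdGaussian E = (Measure.pi fun _ : Fin d => gaussianReal 0 1).map e := by
    rw [stdGaussian_eq_map_pi_orthonormalBasis b]
    congr 1
    funext x
    exact (he_apply x).symm
  rw [h1, pi_gaussianReal_eq_smul_withDensity d one_ne_zero, Measure.map_smul,
    map_withDensity_of_measurePreserving e hmp, inv_sqrt_two_pi_pow]
  -- identify the transported density
  have hdens : (fun ω : Fin d → ℝ => ENNReal.ofReal (rexp (-(∑ i, ω i ^ 2 / 2) / ((1 : NNReal) : ℝ))))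
      ∘ e.symm = fun x : E => ENNReal.ofReal (rexp (-‖x‖ ^ 2 / 2)) := by
    funext x
    simp only [Function.comp_apply, NNReal.coe_one, div_one]
    congr 3
    have hx : e.symm x = (b.repr x).ofLp := by
      apply e.injective
      rw [e.apply_symm_apply, he_apply]
      exact (b.sum_repr x).symm
    rw [hx, ← Finset.sum_div, ← EuclideanSpace.real_norm_sq_eq, b.repr.norm_map]
    ring
  rw [hdens]
  have hfun : (fun x : E => ENNReal.ofReal ((2 * π) ^ (-(d : ℝ) / 2) * rexp (-‖x‖ ^ 2 / 2))) =
      ENNReal.ofReal ((2 * π) ^ (-(d : ℝ) / 2)) • fun x : E => ENNReal.ofReal (rexp (-‖x‖ ^ 2 / 2)) := by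
    funext x
    rw [Pi.smul_apply, smul_eq_mul, ENNReal.ofReal_mul (by positivity)]
  rw [hfun, withDensity_smul _ (by fun_prop)]

/-- The standard Gaussian is absolutely continuous with respect to Lebesgue measure. [folklore] -/
theorem stdGaussian_absolutelyContinuous : stdGaussian E ≪ (volume : Measure E) := by
  rw [stdGaussian_eq_withDensity]
  exact withDensity_absolutelyContinuous _ _

/-- **Proper subspaces are Gaussian-null.** [folklore] -/
theorem stdGaussian_apply_submodule_eq_zero (K : Submodule ℝ E) (hK : K ≠ ⊤) :
    stdGaussian E K = 0 :=
  stdGaussian_absolutelyContinuous (Measure.addHaar_submodule volume K hK)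

/-- Integration against the standard Gaussian is integration against its density
(`ℝ≥0∞` form). [folklore] -/
theorem lintegral_stdGaussian_eq_lintegral_mul {g : E → ℝ≥0∞} (hg : Measurable g) :
    ∫⁻ x, g x ∂(stdGaussian E) =
      ∫⁻ x, ENNReal.ofReal ((2 * π) ^ (-(finrank ℝ E : ℝ) / 2) * rexp (-‖x‖ ^ 2 / 2)) * g x := by
  rw [stdGaussian_eq_withDensity, lintegral_withDensity_eq_lintegral_mul _ (by fun_prop) hg]
  rfl

end Literature.Probability.Distributions
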